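import Literature.Probability.Percolation.FivePointHolomorphyHexBall1
import HarnessLib

/-!
# Five-point discrete holomorphicity at BOUNDARY vertices of the smallest five-marked domain: two kernel witnesses

Topic `Literature/Probability/Percolation`; lane pcv-sawmu (CriticalPhenomena), door (v) «five-point observables on the
honeycomb», successor cell «(H∂)» (b-engine-2 g8). The tree's five-point holomorphicity theorem
`FivePoint.N5.hexFivePointHolomorphy_holds` (`FivePointHolomorphy.lean`) is stated at INTERIOR vertices of `H_Ω`: faces `v` of `𝕋`
with all three sites in `G` (`hexFaceVertices v ⊆ D.verts`). Khristoforov–Smirnov's printed Lemma 4 (three boundary disorders)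
asks only that the three mid-edges at `v` are mid-edges of `Ω`, i.e. (in the tree's vocabulary) that AT LEAST TWO of the three
sites of `v` lie in `G` — so it also covers the valence-3 BOUNDARY vertices of `H_G` (exactly two sites in `G`; two of the three
edges at such a vertex are boundary edges, whose values are governed by `FivePointBoundaryValues.lean`). This file certifies, in
the kernel, the five-point relation `Σ_{k<3} τ^k F_0(v, ccwNbr v k) = 0` at two such boundary vertices of `hexBall1Five`:
the down face `(0,-2)▿` (no corner-face neighbour; counts `26,26,37 | 0,0,0 | 18,29,18` of `2^7`, identity `8(1+τ+τ²) = 0`) and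
the down face `(0,0)▿`, whose first counter-clockwise neighbour IS the corner face `y_1` (counts `33,33,49 | 31,15,15 | 0,0,0`,
identity `18(1+τ+τ²) = 0`). Method = the tree's self-certifying index evaluator for `hexBall1Five`
(`FivePointHolomorphyHexBall1.lean`: `valH`, `patternProb_fc_eq`), `decide +kernel`, standard axioms.

Status in print (lane label): Khristoforov–Smirnov 2021, §2 Lemma 4 (p. 4 of arXiv:2111.15612v1) is the printed three-disorder
relation at every vertex whose three mid-edges lie in `Ω` [cite: KhristoforovSmirnov2021, §2 Definition 3 and Lemma 4 (p. 4)]; the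
five-mark relation at boundary vertices is the lane's cell «(H∂)» (exact on 790/790 boundary (vertex, colour, j) cells of seven
domains, two of them fresh; `HOME/pub-sawmu-b-engine-2/gen8/hd/`), kernel-certified here on two instances; the statement for every
domain is the lane's typed target `HexFivePointHolomorphyBdry` (HOME). Finite bookkeeping over Bollobás–Riordan's marked discrete
domains [cite: BollobasRiordan2006, Ch. 7 §7.2.2]; no new mathematics beyond the certificates.

## References
* M. Khristoforov, S. Smirnov, *Percolation and O(1) loop model*, arXiv:2111.15612 (2021), §2 Definition 3 and Lemma 4 (p. 4).
* B. Bollobás, O. Riordan, *Percolation*, CUP (2006), Ch. 7 §7.2.2 pp. 168–171.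
-/

open Finset Literature.Probability.LatticeModels

noncomputable section

namespace Literature.Probability.Percolation.FivePoint.S0

open Literature.Probability.Percolation Literature.Probability.Percolation.FivePoint

set_option maxRecDepth 400000

/-! ### B1. From a kernel sum of `valH` to the three counts (the tree's private lemmas, restated over a local event name) -/

/-- The pattern-resolved mid-edge event between two listed faces, read on a finite open set (the tree's private `pEventI`). [folklore] -/
private def hbEv (S : Finset (Site 2)) (r : Fin 5) (c m : Bool) (i j : Fin 24) : Prop :=
  PEvent hexBall1Five (↑S) r c m (fc i) (fc j)

open Classical in
/-- The indicator triple of the three pattern events (the tree's `indH`, over `hbEv`). [folklore] -/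
private def indB (S : Finset (Site 2)) (r : Fin 5) (c m : Bool) (i j₀ j₁ j₂ : Fin 24) : ℕ × ℕ × ℕ :=
  (if hbEv S r c m i j₀ then 1 else 0, if hbEv S r c m i j₁ then 1 else 0, if hbEv S r c m i j₂ then 1 else 0)

open Classical in
/-- Specification of `valH`: either the failure triple, or the indicator triple. [folklore] -/
private theorem hb_valH_spec (S : Finset (Site 2)) (r : Fin 5) (c m : Bool) (i j₀ j₁ j₂ : Fin 24) :
    valH S r c m i.val j₀.val j₁.val j₂.val = failH ∨
      valH S r c m i.val j₀.val j₁.val j₂.val = indB S r c m i j₀ j₁ j₂ := by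
  by_cases hP : (IPF S r c).2 = false
  · left; unfold valH; simp [hP]
  have hP' : (IPF S r c).2 = true := by simpa using hP
  by_cases hM : (MF S r c).2 = false
  · left; unfold valH; simp [hP, hM]
  have hM' : (MF S r c).2 = true := by simpa using hM
  have hmatch : ((if m then decide (cornerI (r + 4) ∈ (MF S r c).1) else decide (cornerI (r + 2) ∈ (MF S r c).1)) = true)
      ↔ (if m then MatchB hexBall1Five (↑S) r c else MatchA hexBall1Five (↑S) r c) := by
    cases m
    · simp only [Bool.false_eq_true, ↓reduceIte, decide_eq_true_eq]; exact (matchA_fc_iffF S r c hM').symm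
    · simp only [↓reduceIte, decide_eq_true_eq]; exact (matchB_fc_iffF S r c hM').symm
  by_cases hmt : (if m then decide (cornerI (r + 4) ∈ (MF S r c).1) else decide (cornerI (r + 2) ∈ (MF S r c).1)) = false
  · right
    have hnm : ¬ (if m then MatchB hexBall1Five (↑S) r c else MatchA hexBall1Five (↑S) r c) := by
      intro h; have := hmatch.2 h; rw [hmt] at this; exact Bool.false_ne_true this
    have h0 : ¬ hbEv S r c m i j₀ := fun h => hnm h.1
    have h1 : ¬ hbEv S r c m i j₁ := fun h => hnm h.1
    have h2 : ¬ hbEv S r c m i j₂ := fun h => hnm h.1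
    unfold valH indB
    simp [hP, hM, hmt, h0, h1, h2]
  have hmt' : (if m then decide (cornerI (r + 4) ∈ (MF S r c).1) else decide (cornerI (r + 2) ∈ (MF S r c).1)) = true := by
    rwa [Bool.not_eq_false] at hmt
  have hym : (if m then MatchB hexBall1Five (↑S) r c else MatchA hexBall1Five (↑S) r c) := hmatch.1 hmt'
  by_cases hcr : cornerI r ∈ (IPF S r c).1
  · right
    have hnj : ∀ k : Fin 24, ¬ Joined hexBall1Five (↑S) r c (fc k) := fun k => not_joined_of_corner_mem S r c hP' hcr _
    have h0 : ¬ hbEv S r c m i j₀ := fun h => h.2.elim (hnj i) (hnj j₀)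
    have h1 : ¬ hbEv S r c m i j₁ := fun h => h.2.elim (hnj i) (hnj j₁)
    have h2 : ¬ hbEv S r c m i j₂ := fun h => h.2.elim (hnj i) (hnj j₂)
    unfold valH indB
    simp [hP, hM, hmt', hcr, h0, h1, h2]
  by_cases hQ : (JF (IPF S r c).1 r).2 = false
  · left; unfold valH; simp [hP, hM, hmt', hcr, hQ]
  have hQ' : (JF (IPF S r c).1 r).2 = true := by simpa using hQ
  right
  have hJ : ∀ k : Fin 24, Joined hexBall1Five (↑S) r c (fc k) ↔ k.val ∈ (JF (IPF S r c).1 r).1 := fun k => by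
    rw [joined_fc_iffF S r c hP' rfl hQ' k]
    exact ⟨fun h => h.2, fun h => ⟨hcr, h⟩⟩
  have hev : ∀ k : Fin 24, (i.val ∈ (JF (IPF S r c).1 r).1 ∨ k.val ∈ (JF (IPF S r c).1 r).1) ↔ hbEv S r c m i k := by
    intro k
    unfold hbEv PEvent
    rw [hJ i, hJ k]
    exact ⟨fun h => ⟨hym, h⟩, fun h => h.2⟩
  have key : ∀ k : Fin 24, (if (i.val ∈ (JF (IPF S r c).1 r).1 ∨ k.val ∈ (JF (IPF S r c).1 r).1) then (1 : ℕ) else 0)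
      = (if hbEv S r c m i k then 1 else 0) := fun k => if_congr (hev k) rfl rfl
  unfold valH indB
  simp only [hP', hM', hmt', hcr, hQ', Bool.true_eq_false, ↓reduceIte, key]

open Classical in
/-- From the kernel sum of `valH` (a triple with entries `< 1000`) to the three counts of the pattern events. [folklore] -/
private theorem hb_counts_of_sumH (r : Fin 5) (c m : Bool) (i j₀ j₁ j₂ : Fin 24) {n₀ n₁ n₂ : ℕ}
    (hn₀ : n₀ < 1000)
    (hsum : ∑ S ∈ (triBall 1).powerset, valH S r c m i.val j₀.val j₁.val j₂.val = (n₀, n₁, n₂)) :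
    ((triBall 1).powerset.filter fun S => hbEv S r c m i j₀).card = n₀ ∧
    ((triBall 1).powerset.filter fun S => hbEv S r c m i j₁).card = n₁ ∧
    ((triBall 1).powerset.filter fun S => hbEv S r c m i j₂).card = n₂ := by
  have hval : ∀ S ∈ (triBall 1).powerset, valH S r c m i.val j₀.val j₁.val j₂.val = indB S r c m i j₀ j₁ j₂ := by
    intro S hS
    rcases hb_valH_spec S r c m i j₀ j₁ j₂ with h | h
    · exfalso
      have hle : (valH S r c m i.val j₀.val j₁.val j₂.val).1 ≤
          (∑ T ∈ (triBall 1).powerset, valH T r c m i.val j₀.val j₁.val j₂.val).1 := by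
        rw [Prod.fst_sum]
        exact Finset.single_le_sum (f := fun T => (valH T r c m i.val j₀.val j₁.val j₂.val).1)
          (fun _ _ => Nat.zero_le _) hS
      rw [hsum, h] at hle
      unfold failH at hle
      simp only at hle
      omega
    · exact h
  have hs : ∑ S ∈ (triBall 1).powerset, indB S r c m i j₀ j₁ j₂ = (n₀, n₁, n₂) := by
    rw [← hsum]; exact (Finset.sum_congr rfl hval).symm
  have e0 := congrArg Prod.fst hs
  have e1 := congrArg (fun p => p.2.1) hs
  have e2 := congrArg (fun p => p.2.2) hs
  simp only [Prod.fst_sum, Prod.snd_sum] at e0 e1 e2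
  unfold indB at e0 e1 e2
  simp only at e0 e1 e2
  refine ⟨?_, ?_, ?_⟩
  · rw [Finset.card_filter]; exact e0
  · rw [Finset.card_filter]; exact e1
  · rw [Finset.card_filter]; exact e2

/-! ### B2. The cube root of unity -/

/-- `τ² + τ + 1 = 0`. [folklore] -/
private theorem hb_tau_sq_add_tau_add_one : tau ^ 2 + tau + 1 = 0 := by
  have hprim : IsPrimitiveRoot tau 3 := by
    have h := Complex.isPrimitiveRoot_exp 3 (by norm_num)
    unfold tau
    convert h using 2
    push_cast
    ring
  have h := hprim.geom_sum_eq_zero (by norm_num : 1 < 3)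
  simp only [Finset.sum_range_succ, Finset.sum_range_zero, pow_zero, pow_one, zero_add] at h
  linear_combination h

/-! ### B3. KERNEL: the triple sums at the boundary face `(0,-2)▿` (face 13; neighbours 14, 12, 19 counter-clockwise) -/

set_option maxHeartbeats 400000000 in
/-- Pattern `A`, reference `r = 0`, colour `false`, boundary face 13: counts `26, 26, 37` of `128`. [folklore] -/
private theorem sumH_f13_r0A : ∑ S ∈ (triBall 1).powerset, valH S 0 false false 13 14 12 19 = (26, 26, 37) := by
  decide +kernel

set_option maxHeartbeats 400000000 in
/-- Pattern `B`, reference `r = 1`, colour `false`, boundary face 13: counts `0, 0, 0`. [folklore] -/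
private theorem sumH_f13_r1B : ∑ S ∈ (triBall 1).powerset, valH S 1 false true 13 14 12 19 = (0, 0, 0) := by
  decide +kernel

set_option maxHeartbeats 400000000 in
/-- Pattern `B`, reference `r = 4`, colour `false`, boundary face 13: counts `18, 29, 18`. [folklore] -/
private theorem sumH_f13_r4B : ∑ S ∈ (triBall 1).powerset, valH S 4 false true 13 14 12 19 = (18, 29, 18) := by
  decide +kernel

/-- Face bookkeeping: `fc 13 = (0,-2)▿`. [folklore] -/
private theorem fc13 : fc 13 = (![0, -2], 1) := by decide
/-- Face bookkeeping: `fc 14 = (0,-1)▵`. [folklore] -/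
private theorem fc14 : fc 14 = (![0, -1], 0) := by decide
/-- Face bookkeeping: `fc 12 = (0,-2)▵`. [folklore] -/
private theorem fc12 : fc 12 = (![0, -2], 0) := by decide
/-- Face bookkeeping: `fc 19 = (1,-2)▵`. [folklore] -/
private theorem fc19 : fc 19 = (![1, -2], 0) := by decide

/-- The three counter-clockwise neighbours of `(0,-2)▿` are the listed faces `14, 12, 19`. [folklore] -/
private theorem ccwNbr_f13 :
    ccwNbr (![0, -2], 1) 0 = fc 14 ∧ ccwNbr (![0, -2], 1) 1 = fc 12 ∧ ccwNbr (![0, -2], 1) 2 = fc 19 := by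
  rw [fc14, fc12, fc19]
  refine ⟨?_, ?_, ?_⟩ <;> decide

/-- The face `(0,-2)▿` is a BOUNDARY vertex of `H_G`: exactly two of its three sites (`(1,-2) ∉ G`, `(0,-1), (1,-1) ∈ G`) lie in
`G = triBall 1`, so the tree's interior theorem does not apply to it. [cite: BollobasRiordan2006, Ch. 7 §7.2.2 pp. 168–171] -/
theorem f13_two_sites : ((hexFaceVertices ((![0, -2], 1) : HexVertex)).filter (· ∈ hexBall1Five.verts)).card = 2 ∧
    ¬ hexFaceVertices ((![0, -2], 1) : HexVertex) ⊆ hexBall1Five.verts := by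
  rw [hexBall1Five_verts]
  refine ⟨by decide, by decide⟩

/-- ★ **Five-point discrete holomorphicity at a BOUNDARY vertex, in the kernel**: on `hexBall1Five`, reference `j = 0`, colour
`false`, around the boundary face `v = (0,-2)▿` (two sites in `G`, no corner-face neighbour), `Σ_{k<3} τ^k F_0(v, ccwNbr v k) = 0`
(counts `26,26,37 | 0,0,0 | 18,29,18` of `2^7`; the identity is `(8 + 8τ + 8τ²)/128 = 0` after `τ³ = 1`). [cite: KhristoforovSmirnov2021, §2 Definition 3 and Lemma 4 (p. 4)] -/
theorem fivePointHolomorphyBdry_hexBall1Five_f13 :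
    ∑ k : Fin 3, tau ^ (k : ℕ) * sparseObs hexBall1Five 0 false (![0, -2], 1) (ccwNbr (![0, -2], 1) k) = 0 := by
  obtain ⟨h0, h1, h2⟩ := ccwNbr_f13
  rw [Fin.sum_univ_three]
  simp only [Fin.val_zero, Fin.val_one, Fin.val_two, pow_zero, pow_one, one_mul, h0, h1, h2]
  rw [← fc13]
  obtain ⟨a0, a1, a2⟩ := hb_counts_of_sumH 0 false false 13 14 12 19 (by norm_num) sumH_f13_r0A
  obtain ⟨b0, b1, b2⟩ := hb_counts_of_sumH 1 false true 13 14 12 19 (by norm_num) sumH_f13_r1B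
  obtain ⟨d0, d1, d2⟩ := hb_counts_of_sumH 4 false true 13 14 12 19 (by norm_num) sumH_f13_r4B
  unfold sparseObs
  simp only [zero_add]
  rw [patternProb_fc_eq 0 false false 13 14 a0, patternProb_fc_eq 0 false false 13 12 a1,
    patternProb_fc_eq 0 false false 13 19 a2, patternProb_fc_eq 1 false true 13 14 b0,
    patternProb_fc_eq 1 false true 13 12 b1, patternProb_fc_eq 1 false true 13 19 b2,
    patternProb_fc_eq 4 false true 13 14 d0, patternProb_fc_eq 4 false true 13 12 d1,
    patternProb_fc_eq 4 false true 13 19 d2]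
  push_cast
  linear_combination ((26 - 18 * tau) / 128) * hb_tau_sq_add_tau_add_one

/-! ### B4. KERNEL: the triple sums at the boundary face `(0,0)▿` (face 17; neighbours 18 = the corner face `y_1`, 16, 23) -/

set_option maxHeartbeats 400000000 in
/-- Pattern `A`, reference `r = 0`, colour `false`, boundary face 17: counts `33, 33, 49` of `128`. [folklore] -/
private theorem sumH_f17_r0A : ∑ S ∈ (triBall 1).powerset, valH S 0 false false 17 18 16 23 = (33, 33, 49) := by
  decide +kernel

set_option maxHeartbeats 400000000 in
/-- Pattern `B`, reference `r = 1`, colour `false`, boundary face 17: counts `31, 15, 15`. [folklore] -/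
private theorem sumH_f17_r1B : ∑ S ∈ (triBall 1).powerset, valH S 1 false true 17 18 16 23 = (31, 15, 15) := by
  decide +kernel

set_option maxHeartbeats 400000000 in
/-- Pattern `B`, reference `r = 4`, colour `false`, boundary face 17: counts `0, 0, 0`. [folklore] -/
private theorem sumH_f17_r4B : ∑ S ∈ (triBall 1).powerset, valH S 4 false true 17 18 16 23 = (0, 0, 0) := by
  decide +kernel

/-- Face bookkeeping: `fc 17 = (0,0)▿`. [folklore] -/
private theorem fc17' : fc 17 = (![0, 0], 1) := by decide
/-- Face bookkeeping: `fc 18 = (0,1)▵`. [folklore] -/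
private theorem fc18 : fc 18 = (![0, 1], 0) := by decide
/-- Face bookkeeping: `fc 16 = (0,0)▵`. [folklore] -/
private theorem fc16' : fc 16 = (![0, 0], 0) := by decide
/-- Face bookkeeping: `fc 23 = (1,0)▵`. [folklore] -/
private theorem fc23 : fc 23 = (![1, 0], 0) := by decide

/-- The three counter-clockwise neighbours of `(0,0)▿` are the listed faces `18, 16, 23`. [folklore] -/
private theorem ccwNbr_f17 :
    ccwNbr (![0, 0], 1) 0 = fc 18 ∧ ccwNbr (![0, 0], 1) 1 = fc 16 ∧ ccwNbr (![0, 0], 1) 2 = fc 23 := by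
  rw [fc18, fc16', fc23]
  refine ⟨?_, ?_, ?_⟩ <;> decide

/-- The face `(0,0)▿` is a BOUNDARY vertex of `H_G` (sites `(1,0), (0,1) ∈ G`, `(1,1) ∉ G`) and its first counter-clockwise
neighbour `(0,1)▵` is the CORNER FACE `y_1` of `hexBall1Five`. [cite: BollobasRiordan2006, Ch. 7 §7.2.2 pp. 168–171] -/
theorem f17_two_sites_corner : ((hexFaceVertices ((![0, 0], 1) : HexVertex)).filter (· ∈ hexBall1Five.verts)).card = 2 ∧
    IsCornerFace hexBall1Five 1 (ccwNbr (![0, 0], 1) 0) := by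
  refine ⟨by rw [hexBall1Five_verts]; decide, ?_⟩
  rw [isCornerFace_iff]
  decide

/-- ★ **Five-point discrete holomorphicity at a CORNER-ADJACENT boundary vertex, in the kernel**: on `hexBall1Five`, reference
`j = 0`, colour `false`, around the boundary face `v = (0,0)▿` whose first counter-clockwise neighbour is the corner face `y_1`,
`Σ_{k<3} τ^k F_0(v, ccwNbr v k) = 0` (counts `33,33,49 | 31,15,15 | 0,0,0` of `2^7`; identity `(18 + 18τ + 18τ²)/128 = 0`
after `τ³ = 1`, `τ⁴ = τ`). [cite: KhristoforovSmirnov2021, §2 Definition 3 and Lemma 4 (p. 4)] -/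
theorem fivePointHolomorphyBdry_hexBall1Five_f17 :
    ∑ k : Fin 3, tau ^ (k : ℕ) * sparseObs hexBall1Five 0 false (![0, 0], 1) (ccwNbr (![0, 0], 1) k) = 0 := by
  obtain ⟨h0, h1, h2⟩ := ccwNbr_f17
  rw [Fin.sum_univ_three]
  simp only [Fin.val_zero, Fin.val_one, Fin.val_two, pow_zero, pow_one, one_mul, h0, h1, h2]
  rw [← fc17']
  obtain ⟨a0, a1, a2⟩ := hb_counts_of_sumH 0 false false 17 18 16 23 (by norm_num) sumH_f17_r0A
  obtain ⟨b0, b1, b2⟩ := hb_counts_of_sumH 1 false true 17 18 16 23 (by norm_num) sumH_f17_r1B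
  obtain ⟨d0, d1, d2⟩ := hb_counts_of_sumH 4 false true 17 18 16 23 (by norm_num) sumH_f17_r4B
  unfold sparseObs
  simp only [zero_add]
  rw [patternProb_fc_eq 0 false false 17 18 a0, patternProb_fc_eq 0 false false 17 16 a1,
    patternProb_fc_eq 0 false false 17 23 a2, patternProb_fc_eq 1 false true 17 18 b0,
    patternProb_fc_eq 1 false true 17 16 b1, patternProb_fc_eq 1 false true 17 23 b2,
    patternProb_fc_eq 4 false true 17 18 d0, patternProb_fc_eq 4 false true 17 16 d1,
    patternProb_fc_eq 4 false true 17 23 d2]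
  push_cast
  linear_combination ((33 - 15 * tau ^ 2) / 128) * hb_tau_sq_add_tau_add_one

end Literature.Probability.Percolation.FivePoint.S0

end
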